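import Summits.AtomisticToContinuum.HydrodynamicLimit.Theorems.CellForecastPressureDecay.Negative.LoneParticle
import Literature.Analysis.FluidPDE.HardSphereUniqueness

/-!
# `CellForecastPressureDecay`: the crux functional does not depend on the cluster flows `Ψ`

Audit infrastructure for the crux `AntiMazurCoboundaries.CellForecastPressureDecay`
(stmt-AtomisticToContinuum-13915), from `Cruxes/CellForecastPressureDecay/Disproof.lean` § 10
(seat refuter-cdisprove-stmt-AtomisticToContinuum-13915-g2-0, cycle 2). The crux quantifies `∀ Ψ` over
families of hard-sphere flow STRUCTURES (junk off their good sets, frozen clusters in `clusterStateIn`);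
two refuters argued on paper that this carries no adversarial freedom. Here it is PROVED:

* `volume_restrictTo_preimage_null`: the restriction `z ↦ z|_S` (relabelled) of configurations pulls
  Lebesgue-null sets back to Lebesgue-null sets (coordinate projection: `piEquivPiSubtypeProd`,
  `map_fst_prod`, `piCongrLeft`).
* `ae_restrictTo_mem_good`: under ANY law `particleLaw Φ W` (absolutely continuous w.r.t. Liouville), almost
  surely EVERY sub-configuration `z|_S` is a good datum of the cluster flow `Ψ S.card` (sub-configurations of
  hard-sphere configurations are hard-sphere configurations, good sets are Liouville-conull).
* `clusterStateIn_eq_of_mem_good`: on common good data two families of flows give the same isolated cluster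
  evolution at all times `t ≥ 0` (forward uniqueness `IsHardSphereTrajectory.unique_holds`).
* `lintegral_cruxFunctional_eq`: consequently the crux's left-hand side
  `∫⁻ exp(2c ∑ᵢ T⁻¹∫₀ᵀ g(v^{fc}_i)) dP` is the SAME for any two families `Ψ, Ψ'` (`0 ≤ T`), and so is the law
  `particleLaw (Ψ n) W` (definitionally). Provers may therefore fix `Ψ k := (HardSphereFlow.nonempty_holds hσ k).some`;
  refuters gain nothing from exotic `Ψ`.
-/

open MeasureTheory Set Filter
open scoped ENNReal
open Literature.Analysis.FluidPDE Literature.MathematicalPhysics.KineticTheory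

namespace Summit.AtomisticToContinuum.HydrodynamicLimit.Theorems

noncomputable section

namespace CellForecastPressureDecay

section FlowIndependence

variable {n : ℕ}

/-- Sub-configurations of hard-sphere configurations are hard-sphere configurations. [folklore] -/
theorem restrictTo_mem_hardSphereDomain {d : Type*} [Fintype d] {X : Type*} {G : Geometry d X} {σ : ℝ}
    (S : Finset (Fin n)) {z : Config n d X} (hz : z ∈ hardSphereDomain G n σ) :
    Config.restrictTo S z ∈ hardSphereDomain G S.card σ := by
  rw [mem_hardSphereDomain] at hz ⊢
  intro i j hij
  simp only [Config.restrictTo_apply]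
  exact hz _ _ fun h => hij ((S.orderEmbOfFin rfl).injective h)

/-- **Coordinate projections pull null sets back to null sets**: for a Lebesgue-null measurable
`N ⊆ Config S.card`, the configurations whose restriction to `S` lies in `N` form a Lebesgue-null set
(split the labels as `Fin S.card ⊕ Fin Sᶜ.card ≃ Fin n`, `inl m ↦ S.orderEmbOfFin m`; the restriction is
then the first component of the measure-preserving splitting `sumPiEquivProdPi ∘ piCongrLeft⁻¹`, and
`(vol ⊗ vol)(N × univ) = 0 · ∞ = 0`). [folklore] -/
theorem volume_restrictTo_preimage_null (S : Finset (Fin n)) {N : Set (Config S.card (Fin 3) V3)}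
    (hNm : MeasurableSet N) (hN : volume N = 0) :
    volume {z : Config n (Fin 3) V3 | Config.restrictTo S z ∈ N} = 0 := by
  -- index equivalence `Fin S.card ⊕ Fin Sᶜ.card ≃ Fin n`, `inl m ↦ S.orderEmbOfFin m`
  let e : Fin S.card ⊕ Fin Sᶜ.card ≃ Fin n :=
    (Equiv.sumCongr (S.orderIsoOfFin rfl).toEquiv
      ((Sᶜ.orderIsoOfFin rfl).toEquiv.trans
        (Equiv.subtypeEquivRight (fun i => by simp [Finset.mem_compl])))).trans
      (Equiv.sumCompl fun i => i ∈ S)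
  have he : ∀ m : Fin S.card, e (Sum.inl m) = S.orderEmbOfFin rfl m := by
    intro m
    simp only [e, Equiv.trans_apply, Equiv.sumCongr_apply, Sum.map_inl, Equiv.sumCompl_apply_inl]
    rfl
  let E := MeasurableEquiv.piCongrLeft (fun _ : Fin n => V3 × V3) e
  have hE := measurePreserving_piCongrLeft (fun _ : Fin n => (volume : Measure (V3 × V3))) e
  let F := MeasurableEquiv.sumPiEquivProdPi (fun _ : Fin S.card ⊕ Fin Sᶜ.card => V3 × V3)
  have hF := measurePreserving_sumPiEquivProdPi
    (fun _ : Fin S.card ⊕ Fin Sᶜ.card => (volume : Measure (V3 × V3)))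
  have hG : MeasurePreserving (F ∘ E.symm) (Measure.pi fun _ : Fin n => (volume : Measure (V3 × V3)))
      ((Measure.pi fun _ : Fin S.card => (volume : Measure (V3 × V3))).prod
        (Measure.pi fun _ : Fin Sᶜ.card => (volume : Measure (V3 × V3)))) :=
    hF.comp hE.symm
  have hfac : ∀ z : Config n (Fin 3) V3, (F (E.symm z)).1 = Config.restrictTo S z := by
    intro z
    funext m
    rw [Config.restrictTo_apply, ← he]
    rfl
  have hset : {z : Config n (Fin 3) V3 | Config.restrictTo S z ∈ N} = (F ∘ E.symm) ⁻¹' (N ×ˢ univ) := by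
    ext z
    simp only [mem_setOf_eq, mem_preimage, Function.comp_apply, mem_prod, mem_univ, and_true, hfac]
  haveI : SigmaFinite (Measure.pi fun _ : Fin Sᶜ.card => (volume : Measure (V3 × V3))) :=
    Measure.pi.sigmaFinite _
  rw [hset, volume_pi, hG.measure_preimage (hNm.prod MeasurableSet.univ).nullMeasurableSet,
    Measure.prod_prod, ← volume_pi, hN, zero_mul]

variable {σ : ℝ}

/-- **Almost surely every sub-configuration is a good datum of the cluster flow**, under any law
`particleLaw Φ W` (these are absolutely continuous w.r.t. the Liouville measure). [folklore] -/
theorem ae_restrictTo_mem_good (Φ : HardSphereFlow (Euclidean.geometry (Fin 3)) σ n)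
    (W : Config n (Fin 3) V3 → ℝ) (Ψ : (k : ℕ) → HardSphereFlow (Euclidean.geometry (Fin 3)) σ k) :
    ∀ᵐ z ∂(particleLaw Φ W), ∀ S : Finset (Fin n), Config.restrictTo S z ∈ (Ψ S.card).good := by
  rw [particleLaw_eq]
  refine (withDensity_absolutelyContinuous _ _).ae_le (?_ :
    ∀ᵐ z ∂(liouville (Euclidean.geometry (Fin 3)) n σ), ∀ S : Finset (Fin n),
      Config.restrictTo S z ∈ (Ψ S.card).good)
  rw [liouville_eq, ae_all_iff]
  intro S
  -- null set: restriction in `D^{S.card} \ good`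
  set D := hardSphereDomain (Euclidean.geometry (Fin 3)) n σ with hD
  set Dk := hardSphereDomain (Euclidean.geometry (Fin 3)) S.card σ with hDk
  have hDkm : MeasurableSet Dk := measurableSet_hardSphereDomain _ Euclidean.measurable_geometry_sepVec _ σ
  have hNm : MeasurableSet (Dk \ (Ψ S.card).good) := hDkm.diff (Ψ S.card).measurableSet_good
  have hN : volume (Dk \ (Ψ S.card).good) = 0 := by
    have := (Ψ S.card).measure_compl_good
    rw [liouville_eq, Measure.restrict_apply (Ψ S.card).measurableSet_good.compl] at this
    rwa [sdiff_eq_compl_inter]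
  have h0 := volume_restrictTo_preimage_null S hNm hN
  rw [ae_restrict_iff' (measurableSet_hardSphereDomain _ Euclidean.measurable_geometry_sepVec n σ), ae_iff]
  refine measure_mono_null (fun z hz => ?_) h0
  simp only [mem_setOf_eq, Classical.not_imp] at hz
  exact ⟨restrictTo_mem_hardSphereDomain S hz.1, hz.2⟩

/-- **Two families of cluster flows agree on common good data** at all forward times (forward
uniqueness of hard-sphere trajectories). [folklore] -/
theorem clusterStateIn_eq_of_mem_good (Ψ Ψ' : (k : ℕ) → HardSphereFlow (Euclidean.geometry (Fin 3)) σ k)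
    {S : Finset (Fin n)} {z : Config n (Fin 3) V3} (hz : Config.restrictTo S z ∈ (Ψ S.card).good)
    (hz' : Config.restrictTo S z ∈ (Ψ' S.card).good) (m : Fin S.card) {t : ℝ} (ht : 0 ≤ t) :
    clusterStateIn Ψ S m t z = clusterStateIn Ψ' S m t z := by
  rw [clusterStateIn_of_mem_good Ψ m t hz, clusterStateIn_of_mem_good Ψ' m t hz']
  have h0 : (Ψ S.card).flow 0 (Config.restrictTo S z) = (Ψ' S.card).flow 0 (Config.restrictTo S z) := by
    rw [(Ψ S.card).flow_zero _ hz, (Ψ' S.card).flow_zero _ hz']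
  have := IsHardSphereTrajectory.unique_holds ((Ψ S.card).isTrajectory _ hz)
    ((Ψ' S.card).isTrajectory _ hz') h0 (Set.mem_Ici.2 ht)
  exact congrFun this m

/-- On common good data the local cluster states (the crux's forecasts) agree at forward times. [folklore] -/
theorem localClusterState_eq_of_mem_good
    (Ψ Ψ' : (k : ℕ) → HardSphereFlow (Euclidean.geometry (Fin 3)) σ k) {R : ℝ} {z : Config n (Fin 3) V3}
    (hz : ∀ S : Finset (Fin n), Config.restrictTo S z ∈ (Ψ S.card).good)
    (hz' : ∀ S : Finset (Fin n), Config.restrictTo S z ∈ (Ψ' S.card).good) (i : Fin n) {t : ℝ}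
    (ht : 0 ≤ t) : localClusterState Ψ R t z i = localClusterState Ψ' R t z i := by
  unfold localClusterState
  exact clusterStateIn_eq_of_mem_good Ψ Ψ' (hz _) (hz' _) _ ht

/-- **The crux functional is independent of the cluster flows.** For any two families `Ψ, Ψ'` of
Euclidean hard-sphere flows, any initial density `W`, range `R`, horizon `T ≥ 0`, observable `g` and
tilt `c`, the crux's left-hand side is the same (and `particleLaw (Ψ n) W = particleLaw (Ψ' n) W`
definitionally). [folklore] -/
theorem lintegral_cruxFunctional_eq (Ψ Ψ' : (k : ℕ) → HardSphereFlow (Euclidean.geometry (Fin 3)) σ k)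
    (W : Config n (Fin 3) V3 → ℝ) (R : ℝ) {T : ℝ} (hT : 0 ≤ T) (g : V3 → ℝ) (c : ℝ) :
    ∫⁻ z, ENNReal.ofReal (Real.exp (2 * c * ∑ i : Fin n, T⁻¹ * ∫ t in (0 : ℝ)..T,
        g (localClusterState Ψ R t z i).2)) ∂(particleLaw (Ψ n) W) =
      ∫⁻ z, ENNReal.ofReal (Real.exp (2 * c * ∑ i : Fin n, T⁻¹ * ∫ t in (0 : ℝ)..T,
        g (localClusterState Ψ' R t z i).2)) ∂(particleLaw (Ψ' n) W) := by
  have hlaw : particleLaw (Ψ n) W = particleLaw (Ψ' n) W := rfl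
  rw [hlaw]
  refine lintegral_congr_ae ?_
  filter_upwards [ae_restrictTo_mem_good (Ψ' n) W Ψ, ae_restrictTo_mem_good (Ψ' n) W Ψ'] with z hz hz'
  congr 3
  refine Finset.sum_congr rfl fun i _ => ?_
  congr 1
  refine intervalIntegral.integral_congr fun t ht => ?_
  rw [uIcc_of_le hT] at ht
  simp only [localClusterState_eq_of_mem_good Ψ Ψ' hz hz' i ht.1]

end FlowIndependence

end CellForecastPressureDecay

end

end Summit.AtomisticToContinuum.HydrodynamicLimit.Theorems
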